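import Summits.QuantumFields.YangMills.Theorems.CoarseStiffnessTailCappedCoarseStiffnessLPivotPeeling

/-!
# Route `CoarseStiffnessTail` — THE CORNER CYCLES ARE JOINTLY HAAR: `∫ F(h_0(U),…,h_{d−1}(U)) dU = ∫_{G^d} F dg`
# (lead's certificate, seat `ym-line-cst-p1` g15; helper on 25301 `CappedCoarseStiffnessL`, stub S3 = uniform mean action, P2/(R3))

THE CYCLES.  On the finest torus `T₁^{(0)}` of any `Params` (`n` sites per direction, corner `c* = (−1,…,−1)`), the direction-`k` CYCLE through the
corner is the ordered product `h_k(U) = Π_{i=0}^{n−1} U⟨c* + i·e_k, e_k⟩` of the `n` bond variables of the straight closed line through `c*` in direction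
`k` — all of them FREE bonds of the corner-comb family (`…LCornerCombBound.image_pivot_eq`).

THE THEOREM (`lintegral_cornerCycles_eq`, any gauge group with Haar data and measurable multiplication, any measurable `F : (Fin d → G) → ℝ≥0∞`):
`∫⁻ F(k ↦ h_k(U)) dU = ∫⁻ F dHaar^{⊗d}`.  Proof: (§2) integrating the `d` corner bonds `⟨c*, e_k⟩` first, `h_k = U⟨c*,e_k⟩·R_k` with `R_k` free of
corner bonds, and `Haar^{⊗S}` is right invariant, so the marginal over the corner bonds of `F∘h` equals that of `F∘(corner bonds)`
(`lmarginal_cornerCycles_eq`); (§3) the corner-bond projection `U ↦ (k ↦ U⟨c*, e_k⟩)` pushes the product Haar measure of all bonds to `Haar^{⊗d}`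
(`measurePreserving_cornerProj`, by `Measure.pi_eq` on boxes).

WHY (line card §g15, P2).  In the exact-exponent UPPER bound the spectator `exp(−s·Σ_{k<l}(1 − Re tr[h_k, h_l]))` survives the peeling of the
corner-comb family; this file turns its integral into the finite-dimensional `J_d(s) = ∫_{G^d} exp(−s Σ_{k<l}(1 − Re tr[g_k,g_l])) dg`.

HONEST SCOPE.  Kernel measure theory; nothing of Bałaban's is asserted; the crux 25301, its stubs S1/S2/S3, `HistoryTailL` 19936 stay OPEN;
`YM3TorusSU2` (R3, RECORD rung, not Clay) is NOT proved; the Yang–Mills mass gap is NOT touched.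

References: I. Montvay, G. Münster, *Quantum Fields on a Lattice* (1994) §3.2.5 [MontvayMunster1994]; T. Bałaban, CMP **102** (1985) 255–275
[Balaban1985UV3] ((1)–(3) p.256).
-/

noncomputable section

open MeasureTheory
open scoped ENNReal BigOperators

namespace Summit.QuantumFields.YangMills.Theorems.CoarseStiffnessTailCornerCycles

open Literature.MathematicalPhysics.QuantumFieldTheory.Balaban1983to89 Literature.MathematicalPhysics.QuantumFieldTheory.Balaban1983to89.Missing
open Summit.QuantumFields.BalabanUV.T4Continuum.NE7b.BarePartitionFnDecay (one_ne_zero_coord one_lt_sitesPerDir_zero)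

variable {G : Type*} [GaugeGroup G] [MeasurableSpace G] [HaarData G]
variable (P : Params)

/-! ## §1 The cycle splits off its corner bond -/

section Split

omit [MeasurableSpace G] [HaarData G] in
/-- `Π_{i<n} f(i) = f(0) · Π_{i<n−1} f(i+1)` for an ordered list product (`n ≥ 1`). [folklore] -/
theorem prod_range_eq_head_mul_tail {M : Type*} [Monoid M] (f : ℕ → M) {n : ℕ} (hn : 0 < n) :
    ((List.range n).map f).prod = f 0 * ((List.range (n - 1)).map fun i => f (i + 1)).prod := by
  obtain ⟨m, rfl⟩ := Nat.exists_eq_succ_of_ne_zero hn.ne'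
  rw [List.range_succ_eq_map, List.map_cons, List.prod_cons, List.map_map]
  simp only [Nat.succ_sub_one]
  rfl

omit [MeasurableSpace G] [HaarData G] in
/-- `h_k(U) = U⟨c*, e_k⟩ · Π_{i=1}^{n−1} U⟨c* + i e_k, e_k⟩`. [folklore] -/
theorem cycle_eq_corner_mul_tail (U : GaugeField P 0 G) (k : Fin P.d) :
    ((List.range (P.sitesPerDir 0)).map fun i : ℕ =>
        U ⟨Function.update (fun _ => (-1 : ZMod (P.sitesPerDir 0))) k (-1 + (i : ZMod (P.sitesPerDir 0))), k⟩).prod =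
      U ⟨fun _ => (-1 : ZMod (P.sitesPerDir 0)), k⟩ *
        ((List.range (P.sitesPerDir 0 - 1)).map fun i : ℕ =>
          U ⟨Function.update (fun _ => (-1 : ZMod (P.sitesPerDir 0))) k (-1 + ((i + 1 : ℕ) : ZMod (P.sitesPerDir 0))), k⟩).prod := by
  rw [prod_range_eq_head_mul_tail _ (Nat.pos_of_ne_zero (P.sitesPerDir_ne_zero 0))]
  congr 2
  simp

omit [HaarData G] in
/-- Measurability of an ordered product of bond variables. [folklore] -/
theorem measurable_listProd_range [MeasurableMul₂ G] (b : ℕ → PBond P 0) (m : ℕ) :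
    Measurable fun U : GaugeField P 0 G => ((List.range m).map fun i => U (b i)).prod := by
  induction m with
  | zero => simp only [List.range_zero, List.map_nil, List.prod_nil]; exact measurable_const
  | succ m ih =>
    have h : (fun U : GaugeField P 0 G => ((List.range (m + 1)).map fun i => U (b i)).prod) =
        fun U => ((List.range m).map fun i => U (b i)).prod * U (b m) := by
      funext U; rw [List.range_succ, List.map_append, List.prod_append, List.map_singleton, List.prod_singleton]
    rw [h]
    exact ih.mul (measurable_pi_apply _)

omit [MeasurableSpace G] [HaarData G] in
/-- The tail bonds are not corner bonds: `c* + (i+1)e_k ≠ c*` for `i + 1 < n`. [folklore] -/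
theorem tail_src_ne_corner (k : Fin P.d) {i : ℕ} (hi : i + 1 < P.sitesPerDir 0) :
    Function.update (fun _ => (-1 : ZMod (P.sitesPerDir 0))) k (-1 + ((i + 1 : ℕ) : ZMod (P.sitesPerDir 0))) ≠
      fun _ => (-1 : ZMod (P.sitesPerDir 0)) := by
  intro h
  have hk := congrFun h k
  rw [Function.update_self] at hk
  have h0 : ((i + 1 : ℕ) : ZMod (P.sitesPerDir 0)) = 0 := by
    have := add_left_cancel (a := (-1 : ZMod (P.sitesPerDir 0))) (hk.trans (add_zero _).symm)
    exact this
  rw [ZMod.natCast_eq_zero_iff] at h0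
  exact absurd (Nat.le_of_dvd (Nat.succ_pos i) h0) (not_le.2 hi)

end Split

/-! ## §2 The marginal over the corner bonds: cycles may be replaced by the corner bonds -/

section Marginal

variable [MeasurableMul₂ G] [DecidableEq (PBond P 0)]

/-- **★ `∫⋯∫⁻_{corner bonds} F(h(U)) = ∫⋯∫⁻_{corner bonds} F(k ↦ U⟨c*, e_k⟩)`** (right invariance of `Haar^{⊗S}`; the tails do not contain corner bonds).
[folklore] -/
theorem lmarginal_cornerCycles_eq (F : (Fin P.d → G) → ℝ≥0∞) :
    (∫⋯∫⁻_(Finset.univ.image fun k : Fin P.d => (⟨fun _ => (-1 : ZMod (P.sitesPerDir 0)), k⟩ : PBond P 0)),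
        (fun U : GaugeField P 0 G => F fun k => ((List.range (P.sitesPerDir 0)).map fun i : ℕ =>
          U ⟨Function.update (fun _ => (-1 : ZMod (P.sitesPerDir 0))) k (-1 + (i : ZMod (P.sitesPerDir 0))), k⟩).prod)
        ∂(fun _ : PBond P 0 => (HaarData.haar : Measure G))) =
      ∫⋯∫⁻_(Finset.univ.image fun k : Fin P.d => (⟨fun _ => (-1 : ZMod (P.sitesPerDir 0)), k⟩ : PBond P 0)),
        (fun U : GaugeField P 0 G => F fun k => U ⟨fun _ => (-1 : ZMod (P.sitesPerDir 0)), k⟩)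
        ∂(fun _ : PBond P 0 => (HaarData.haar : Measure G)) := by
  classical
  set S : Finset (PBond P 0) := Finset.univ.image fun k : Fin P.d =>
    (⟨fun _ => (-1 : ZMod (P.sitesPerDir 0)), k⟩ : PBond P 0) with hS
  have hmem : ∀ k : Fin P.d, (⟨fun _ => (-1 : ZMod (P.sitesPerDir 0)), k⟩ : PBond P 0) ∈ S := fun k =>
    Finset.mem_image_of_mem _ (Finset.mem_univ k)
  have htail : ∀ (k : Fin P.d) (i : ℕ), i + 1 < P.sitesPerDir 0 →
      (⟨Function.update (fun _ => (-1 : ZMod (P.sitesPerDir 0))) k (-1 + ((i + 1 : ℕ) : ZMod (P.sitesPerDir 0))), k⟩ :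
        PBond P 0) ∉ S := by
    intro k i hi hc
    obtain ⟨k', _, hk'⟩ := Finset.mem_image.1 hc
    exact tail_src_ne_corner P k hi (congrArg PBond.src hk').symm
  ext x
  simp only [lmarginal]
  -- the tails, as a function of the outer variable only
  set R : Fin P.d → G := fun k => ((List.range (P.sitesPerDir 0 - 1)).map fun i : ℕ =>
    x ⟨Function.update (fun _ => (-1 : ZMod (P.sitesPerDir 0))) k (-1 + ((i + 1 : ℕ) : ZMod (P.sitesPerDir 0))), k⟩).prod
    with hR
  set ρ : (↥S → G) := fun s => R s.1.dir with hρ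
  -- integrand rewriting
  have hupd : ∀ (y : ↥S → G) (k : Fin P.d),
      ((List.range (P.sitesPerDir 0)).map fun i : ℕ => (Function.updateFinset x S y)
        ⟨Function.update (fun _ => (-1 : ZMod (P.sitesPerDir 0))) k (-1 + (i : ZMod (P.sitesPerDir 0))), k⟩).prod =
        (y * ρ) ⟨⟨fun _ => (-1 : ZMod (P.sitesPerDir 0)), k⟩, hmem k⟩ := by
    intro y k
    rw [cycle_eq_corner_mul_tail P (Function.updateFinset x S y) k, Pi.mul_apply]
    congr 1
    · simp only [Function.updateFinset]
      exact dif_pos (hmem k)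
    · show ((List.range (P.sitesPerDir 0 - 1)).map fun i : ℕ => Function.updateFinset x S y
          ⟨Function.update (fun _ => (-1 : ZMod (P.sitesPerDir 0))) k (-1 + ((i + 1 : ℕ) : ZMod (P.sitesPerDir 0))), k⟩).prod = R k
      rw [hR]
      congr 1
      refine List.map_congr_left fun i hi => ?_
      have hi' : i + 1 < P.sitesPerDir 0 := by have := List.mem_range.1 hi; omega
      simp only [Function.updateFinset]
      exact dif_neg (htail k i hi')
  have hproj : ∀ (y : ↥S → G) (k : Fin P.d),
      (Function.updateFinset x S y) ⟨fun _ => (-1 : ZMod (P.sitesPerDir 0)), k⟩ =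
        y ⟨⟨fun _ => (-1 : ZMod (P.sitesPerDir 0)), k⟩, hmem k⟩ := by
    intro y k
    simp only [Function.updateFinset]
    exact dif_pos (hmem k)
  simp_rw [hupd, hproj]
  -- right invariance of the product Haar measure on `↥S → G`
  exact lintegral_mul_right_eq_self (μ := Measure.pi fun _ : ↥S => (HaarData.haar : Measure G))
    (fun y : ↥S → G => F fun k => y ⟨⟨fun _ => (-1 : ZMod (P.sitesPerDir 0)), k⟩, hmem k⟩) ρ

end Marginal

/-! ## §3 The corner-bond projection pushes the product Haar measure to `Haar^{⊗d}` -/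

section Proj

/-- **★ THE CORNER PROJECTION IS MEASURE PRESERVING**: `U ↦ (k ↦ U⟨c*, e_k⟩)` maps `Π_b dU(b)` to `Haar^{⊗d}`. [folklore] -/
theorem measurePreserving_cornerProj :
    MeasurePreserving (fun U : GaugeField P 0 G => fun k : Fin P.d => U ⟨fun _ => (-1 : ZMod (P.sitesPerDir 0)), k⟩)
      (fieldMeasure P 0 G) (Measure.pi fun _ : Fin P.d => (HaarData.haar : Measure G)) := by
  classical
  haveI : IsProbabilityMeasure (HaarData.haar (G := G)) := HaarData.isProb
  set cstar : Site P 0 := fun _ => (-1 : ZMod (P.sitesPerDir 0)) with hcstar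
  have hmeas : Measurable fun U : GaugeField P 0 G => fun k : Fin P.d => U ⟨cstar, k⟩ :=
    measurable_pi_lambda _ fun k => measurable_pi_apply _
  refine ⟨hmeas, ?_⟩
  symm
  refine Measure.pi_eq fun s hs => ?_
  rw [Measure.map_apply hmeas (MeasurableSet.univ_pi hs)]
  -- the preimage of a box is a box in the big product
  have hpre : (fun U : GaugeField P 0 G => fun k : Fin P.d => U ⟨cstar, k⟩) ⁻¹' (Set.univ.pi s) =
      Set.univ.pi fun b : PBond P 0 => if b.src = cstar then s b.dir else Set.univ := by
    ext U
    rw [Set.mem_preimage, Set.mem_univ_pi]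
    constructor
    · intro h
      refine Set.mem_univ_pi.mpr fun b => ?_
      by_cases hb : b.src = cstar
      · rw [if_pos hb]
        have : b = ⟨cstar, b.dir⟩ := by cases b; simp only at hb; subst hb; rfl
        rw [this]; exact h b.dir
      · rw [if_neg hb]; exact Set.mem_univ _
    · intro h k
      have := (Set.mem_univ_pi.mp h) ⟨cstar, k⟩
      dsimp only at this
      rwa [if_pos rfl] at this
  rw [hpre]
  show (Measure.pi fun _ : PBond P 0 => (HaarData.haar : Measure G))
      (Set.univ.pi fun b : PBond P 0 => if b.src = cstar then s b.dir else Set.univ) = ∏ i, (HaarData.haar : Measure G) (s i)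
  rw [Measure.pi_pi]
  -- the product over all bonds of `haar(s dir)` on corner bonds and `1` elsewhere
  have hsplit : ∀ b : PBond P 0, (HaarData.haar : Measure G) (if b.src = cstar then s b.dir else Set.univ) =
      if b.src = cstar then (HaarData.haar : Measure G) (s b.dir) else 1 := by
    intro b; split_ifs <;> simp
  simp_rw [hsplit]
  rw [Finset.prod_ite, Finset.prod_const_one, mul_one]
  -- reindex the corner bonds by their direction
  have himg : (Finset.univ.filter fun b : PBond P 0 => b.src = cstar) =
      (Finset.univ : Finset (Fin P.d)).image fun δ => (⟨cstar, δ⟩ : PBond P 0) := by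
    ext b
    simp only [Finset.mem_filter, Finset.mem_univ, true_and, Finset.mem_image]
    constructor
    · intro hb; exact ⟨b.dir, by cases b; simp only at hb; subst hb; rfl⟩
    · rintro ⟨δ, rfl⟩; rfl
  rw [himg, Finset.prod_image (fun δ _ δ' _ h => congrArg PBond.dir h)]

/-- **★★ THE CORNER CYCLES ARE JOINTLY HAAR**: for every measurable `F : (Fin d → G) → ℝ≥0∞`,
`∫⁻ F(k ↦ Π_{i<n} U⟨c* + i e_k, e_k⟩) dU = ∫⁻ F dHaar^{⊗d}`. [folklore] -/
theorem lintegral_cornerCycles_eq [MeasurableMul₂ G] (F : (Fin P.d → G) → ℝ≥0∞) (hF : Measurable F) :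
    ∫⁻ U, F (fun k => ((List.range (P.sitesPerDir 0)).map fun i : ℕ =>
        U ⟨Function.update (fun _ => (-1 : ZMod (P.sitesPerDir 0))) k (-1 + (i : ZMod (P.sitesPerDir 0))), k⟩).prod)
        ∂fieldMeasure P 0 G =
      ∫⁻ g, F g ∂(Measure.pi fun _ : Fin P.d => (HaarData.haar : Measure G)) := by
  classical
  haveI : IsProbabilityMeasure (HaarData.haar (G := G)) := HaarData.isProb
  -- measurability of the two integrands on the big space
  have hcyc : Measurable fun U : GaugeField P 0 G => fun k : Fin P.d => ((List.range (P.sitesPerDir 0)).map fun i : ℕ =>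
      U ⟨Function.update (fun _ => (-1 : ZMod (P.sitesPerDir 0))) k (-1 + (i : ZMod (P.sitesPerDir 0))), k⟩).prod := by
    exact measurable_pi_lambda _ fun k => measurable_listProd_range P _ _
  have hproj : Measurable fun U : GaugeField P 0 G => fun k : Fin P.d => U ⟨fun _ => (-1 : ZMod (P.sitesPerDir 0)), k⟩ :=
    measurable_pi_lambda _ fun k => measurable_pi_apply _
  have h1 := lintegral_eq_of_lmarginal_eq (μ := fun _ : PBond P 0 => (HaarData.haar : Measure G))
    (Finset.univ.image fun k : Fin P.d => (⟨fun _ => (-1 : ZMod (P.sitesPerDir 0)), k⟩ : PBond P 0))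
    (hF.comp hcyc) (hF.comp hproj) (lmarginal_cornerCycles_eq P F)
  have h2 := (measurePreserving_cornerProj P (G := G)).lintegral_comp hF
  calc ∫⁻ U, F (fun k => ((List.range (P.sitesPerDir 0)).map fun i : ℕ =>
          U ⟨Function.update (fun _ => (-1 : ZMod (P.sitesPerDir 0))) k (-1 + (i : ZMod (P.sitesPerDir 0))), k⟩).prod)
          ∂fieldMeasure P 0 G
      = ∫⁻ U, F (fun k : Fin P.d => U ⟨fun _ => (-1 : ZMod (P.sitesPerDir 0)), k⟩) ∂fieldMeasure P 0 G := h1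
    _ = ∫⁻ g, F g ∂(Measure.pi fun _ : Fin P.d => (HaarData.haar : Measure G)) := h2

end Proj

end Summit.QuantumFields.YangMills.Theorems.CoarseStiffnessTailCornerCycles

end
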